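import Mathlib

/-!
# Screening estimates for a finite array of independent biased bits, part 1: definitions, Walsh coefficients

Support file (`--supports stmt-CriticalPhenomena-5076`) for the stub `stub_Screening` of the line
`pinned-diagram-exchange` (crux `IKLinearTransport`, sub-goals `screeningArray`, `screeningOffset`).
Setting: an `m × k` array `q : Fin m × Fin k → Bool` of INDEPENDENT bits, the entry `(c, r)` being `true` with
probability `p c` (column-dependent bias); `arrSum p F = Σ_q arrWeight p q · F q` is the expectation of `F`.
This part carries the definitions (`arrWeight`, `arrSum`, `colPar`, `rowPar`, `parities`, `sigmaStar`, `tailPar`,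
`boxData`; helpers `sgnR`, `parS`, `chiY`, `xSet`, `epsCR`, `nOut`) and the one-entry resampling identities
leading to the WALSH COEFFICIENT FACTORISATION `arrSum_chiY_mul` (registered helper):
`E[χ_Y K] = (∏_{f ∈ Y} (1 - 2 p_{f.1})) · E[K]` whenever `K` reads no entry of `Y`, where
`χ_Y(q) = ∏_{f ∈ Y} (-1)^{q f}`; together with `Σ_q arrWeight p q = 1`, `|E[H]| ≤ 1` for `|H| ≤ 1`, and
`|∏_{f ∈ Y} (1 - 2 p_{f.1})| ≤ θ^n` for `#Y ≥ n`, `|1 - 2 p_c| ≤ θ ≤ 1`.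
Sequels: part 2 (flip lemma, `screeningOffset`), part 3 (Fourier–Walsh expansion of the parity indicator,
counting of unread entries), part 4 (`screeningArray`).
-/

noncomputable section

namespace Summit.CriticalPhenomena.CardyFormulaZ2.Theorems.IKLinearTransport.PinnedDiagramExchange.ScreeningArray

open Finset

variable {m k : ℕ}

/-- Weight of one `m × k` array of bits under independent entries, the entry `(c, r)` being `true` with
probability `p c` (column-dependent bias). [folklore] -/
def arrWeight (p : Fin m → ℝ) (q : Fin m × Fin k → Bool) : ℝ :=
  ∏ f : Fin m × Fin k, (if q f then p f.1 else 1 - p f.1)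

/-- Weighted sum (expectation) of a real function of the array. [folklore] -/
def arrSum (p : Fin m → ℝ) (F : (Fin m × Fin k → Bool) → ℝ) : ℝ :=
  ∑ q : Fin m × Fin k → Bool, arrWeight p q * F q

/-- Parity of the column `c`. [folklore] -/
def colPar (q : Fin m × Fin k → Bool) (c : Fin m) : Bool :=
  decide (Odd ((univ.filter fun r : Fin k => q (c, r) = true).card))

/-- Parity of the row `r`. [folklore] -/
def rowPar (q : Fin m × Fin k → Bool) (r : Fin k) : Bool :=
  decide (Odd ((univ.filter fun c : Fin m => q (c, r) = true).card))

/-- All column parities and all row parities. [folklore] -/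
def parities (q : Fin m × Fin k → Bool) : (Fin m → Bool) × (Fin k → Bool) := (colPar q, rowPar q)

/-- The screening sum `Σ*`: an upper bound for `Σ_{(C,R) ∉ {(∅,∅),(all,all)}} θ^{#(X(C,R) ∩ nonUR)}`,
`X(C,R) = C × Rᶜ ∪ Cᶜ × R`, `nonUR = {c < n} × rows ∪ cols × {r < n}` (case split on `C ∩ {c<n}`,
`R ∩ {r<n}`: both empty → `(1+θ^n)^{(m-n)+(k-n)} - 1`; both full → the same by complement symmetry;
`R ∩ {r<n}` proper → `≥ m` faces; `C ∩ {c<n}` proper → `≥ k` faces; the two mixed extreme cases → `≥ n²`). [folklore] -/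
def sigmaStar (m k n : ℕ) (θ : ℝ) : ℝ :=
  2 * ((1 + θ ^ n) ^ (m + k - 2 * n) - 1) + 2 ^ (m + k) * (θ ^ m + θ ^ k) + 2 ^ (m + k + 1) * θ ^ (n * n)

/-- Tail parity: parity of the entries `(c, r)` with `i ≤ c` and `j ≤ r`. [folklore] -/
def tailPar (q : Fin m × Fin k → Bool) (i j : ℕ) : Bool :=
  decide (Odd ((univ.filter fun f : Fin m × Fin k => i ≤ (f.1 : ℕ) ∧ j ≤ (f.2 : ℕ) ∧ q f = true).card))

/-- Box data: the `w × h` array of tail parities anchored at the cells `(n + i, n + j)`. [folklore] -/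
def boxData (n w h : ℕ) (q : Fin m × Fin k → Bool) : Fin w × Fin h → Bool :=
  fun ij => tailPar q (n + ij.1) (n + ij.2)

/-! ## Signs, parities and Walsh characters of sets of entries -/

/-- The sign `(-1)^b` of a bit `b`. [folklore] -/
def sgnR (b : Bool) : ℝ := if b then -1 else 1

/-- Parity of the entries of the array `q` lying in the set `S`. [folklore] -/
def parS (S : Finset (Fin m × Fin k)) (q : Fin m × Fin k → Bool) : Bool :=
  decide (Odd ((S.filter fun f => q f = true).card))

/-- Walsh character of the set of entries `S`: the product of the signs of the entries in `S`. [folklore] -/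
def chiY (S : Finset (Fin m × Fin k)) (q : Fin m × Fin k → Bool) : ℝ := ∏ f ∈ S, sgnR (q f)

/-! ## Exchange sets and their signs (the index set of the Fourier–Walsh expansion, part 3) -/

/-- The exchange set `X(C,R) = {(c, r) : [c ∈ C] ≠ [r ∈ R]}` of a column set `C` and a row set `R`. [folklore] -/
def xSet (C : Fin m → Bool) (R : Fin k → Bool) : Finset (Fin m × Fin k) :=
  univ.filter fun f => xor (C f.1) (R f.2) = true

/-- The sign `ε(C,R) = (-1)^{Σ_{c ∈ C} kk.1 c + Σ_{r ∈ R} kk.2 r}` of a pair `(C, R)` relative to `kk`. [folklore] -/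
def epsCR (kk : (Fin m → Bool) × (Fin k → Bool)) (C : Fin m → Bool) (R : Fin k → Bool) : ℝ :=
  (∏ c, if C c then sgnR (kk.1 c) else 1) * ∏ r, if R r then sgnR (kk.2 r) else 1

/-- Number of entries of the exchange set `X(C,R)` outside the upper-right region `{c ≥ n} × {r ≥ n}`. [folklore] -/
def nOut (n : ℕ) (C : Fin m → Bool) (R : Fin k → Bool) : ℕ :=
  ((xSet C R).filter fun f => ¬(n ≤ (f.1 : ℕ) ∧ n ≤ (f.2 : ℕ))).card

/-- A product of signs is the sign of the parity of the number of `true` bits. -/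
theorem prod_sgnR {α : Type*} (s : Finset α) (g : α → Bool) :
    ∏ a ∈ s, sgnR (g a) = sgnR (decide (Odd (s.filter fun a => g a = true).card)) := by
  simp only [sgnR]
  rw [Finset.prod_ite, Finset.prod_const, Finset.prod_const_one, mul_one]
  rcases Nat.even_or_odd ((s.filter fun a => g a = true).card) with h | h
  · rw [h.neg_one_pow, if_neg]
    simpa [Nat.not_odd_iff_even] using h
  · rw [h.neg_one_pow, if_pos]
    simpa using h

/-- The Walsh character of `S` is the sign of the parity of `S`. -/
theorem chiY_eq_sgnR_parS (S : Finset (Fin m × Fin k)) (q : Fin m × Fin k → Bool) :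
    chiY S q = sgnR (parS S q) :=
  prod_sgnR S q

/-- `sgnR b * sgnR b = 1`. -/
theorem sgnR_mul_self (b : Bool) : sgnR b * sgnR b = 1 := by
  cases b <;> simp [sgnR]

/-- `|sgnR b| = 1`. -/
theorem abs_sgnR (b : Bool) : |sgnR b| = 1 := by
  cases b <;> simp [sgnR]

/-! ## The product measure: total mass, positivity, one-entry resampling -/

/-- The weights are nonnegative when all biases lie in `[0, 1]`. -/
theorem arrWeight_nonneg (p : Fin m → ℝ) (hp : ∀ c, 0 ≤ p c ∧ p c ≤ 1) (q : Fin m × Fin k → Bool) :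
    0 ≤ arrWeight p q :=
  Finset.prod_nonneg fun f _ => by
    have h := hp f.1
    split_ifs <;> linarith

/-- Total mass one: `Σ_q arrWeight p q = 1`. -/
theorem sum_arrWeight (p : Fin m → ℝ) : ∑ q : Fin m × Fin k → Bool, arrWeight p q = 1 := by
  unfold arrWeight
  rw [← Fintype.prod_sum fun (f : Fin m × Fin k) (b : Bool) => if b then p f.1 else 1 - p f.1]
  simp

/-- `|arrSum p H| ≤ 1` for `|H| ≤ 1`. -/
theorem abs_arrSum_le_one (p : Fin m → ℝ) (hp : ∀ c, 0 ≤ p c ∧ p c ≤ 1)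
    (H : (Fin m × Fin k → Bool) → ℝ) (hH : ∀ q, |H q| ≤ 1) : |arrSum p H| ≤ 1 := by
  unfold arrSum
  calc |∑ q, arrWeight p q * H q| ≤ ∑ q, |arrWeight p q * H q| := abs_sum_le_sum_abs _ _
    _ ≤ ∑ q : Fin m × Fin k → Bool, arrWeight p q := Finset.sum_le_sum fun q _ => by
        rw [abs_mul, abs_of_nonneg (arrWeight_nonneg p hp q)]
        exact mul_le_of_le_one_right (arrWeight_nonneg p hp q) (hH q)
    _ = 1 := sum_arrWeight p

/-- `arrSum` is linear: differences. -/
theorem arrSum_sub (p : Fin m → ℝ) (H H' : (Fin m × Fin k → Bool) → ℝ) :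
    arrSum p H - arrSum p H' = arrSum p (fun q => H q - H' q) := by
  unfold arrSum
  rw [← Finset.sum_sub_distrib]
  exact Finset.sum_congr rfl fun q _ => by ring

/-- One-entry resampling: if `M` does not read the entry `f₀`, then
`Σ_q φ(q f₀) M(q) = (φ true + φ false) Σ_{q : q f₀ = false} M(q)`. -/
theorem sum_onebit (f₀ : Fin m × Fin k) (φ : Bool → ℝ) (M : (Fin m × Fin k → Bool) → ℝ)
    (hM : ∀ q b, M (Function.update q f₀ b) = M q) :
    ∑ q : Fin m × Fin k → Bool, φ (q f₀) * M q =
      (φ true + φ false) * ∑ q : Fin m × Fin k → Bool, (if q f₀ = false then M q else 0) := by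
  have hinv : Function.Involutive (fun q : Fin m × Fin k → Bool => Function.update q f₀ (!q f₀)) := by
    intro q
    simp [Function.update_idem]
  have h1 : ∀ q : Fin m × Fin k → Bool, φ (q f₀) * M q =
      (if q f₀ = false then φ false * M q else 0) + (if q f₀ = true then φ true * M q else 0) := by
    intro q
    cases q f₀ <;> simp
  have h2 : ∑ q : Fin m × Fin k → Bool, (if q f₀ = true then φ true * M q else 0) =
      ∑ q : Fin m × Fin k → Bool, (if q f₀ = false then φ true * M q else 0) := by
    refine Fintype.sum_equiv (hinv.toPerm _) _ _ fun q => ?_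
    simp only [Function.Involutive.coe_toPerm, Function.update_self, hM]
    cases q f₀ <;> simp
  rw [Finset.sum_congr rfl fun q _ => h1 q, Finset.sum_add_distrib, h2, ← Finset.sum_add_distrib,
    Finset.mul_sum]
  refine Finset.sum_congr rfl fun q _ => ?_
  split_ifs <;> ring

/-- One-entry Walsh coefficient: if `K` does not read the entry `f₀`, then
`Σ_q w(q) (-1)^{q f₀} K(q) = (1 - 2 p_{f₀.1}) Σ_q w(q) K(q)`. -/
theorem arrSum_sgnR_mul (p : Fin m → ℝ) (f₀ : Fin m × Fin k) (K : (Fin m × Fin k → Bool) → ℝ)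
    (hK : ∀ q b, K (Function.update q f₀ b) = K q) :
    arrSum p (fun q => sgnR (q f₀) * K q) = (1 - 2 * p f₀.1) * arrSum p K := by
  -- split off the factor of the weight at `f₀`
  set R : (Fin m × Fin k → Bool) → ℝ :=
    fun q => ∏ f ∈ univ.erase f₀, (if q f then p f.1 else 1 - p f.1) with hR
  have hw : ∀ q : Fin m × Fin k → Bool,
      arrWeight p q = (if q f₀ then p f₀.1 else 1 - p f₀.1) * R q := fun q =>
    (Finset.mul_prod_erase univ (fun f => if q f then p f.1 else 1 - p f.1) (mem_univ f₀)).symm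
  have hRinv : ∀ q b, R (Function.update q f₀ b) = R q := fun q b =>
    Finset.prod_congr rfl fun f hf => by rw [Function.update_of_ne (ne_of_mem_erase hf)]
  have hM : ∀ q b, R (Function.update q f₀ b) * K (Function.update q f₀ b) = R q * K q := fun q b => by
    rw [hRinv, hK]
  have h1 : arrSum p (fun q => sgnR (q f₀) * K q) =
      ∑ q : Fin m × Fin k → Bool, ((if q f₀ then p f₀.1 else 1 - p f₀.1) * sgnR (q f₀)) * (R q * K q) := by
    unfold arrSum
    exact Finset.sum_congr rfl fun q _ => by rw [hw]; ring
  have h2 : arrSum p K = ∑ q : Fin m × Fin k → Bool, (if q f₀ then p f₀.1 else 1 - p f₀.1) * (R q * K q) := by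
    unfold arrSum
    exact Finset.sum_congr rfl fun q _ => by rw [hw]; ring
  rw [h1, h2, sum_onebit f₀ (fun b => (if b then p f₀.1 else 1 - p f₀.1) * sgnR b) (fun q => R q * K q) hM,
    sum_onebit f₀ (fun b => if b then p f₀.1 else 1 - p f₀.1) (fun q => R q * K q) hM]
  simp only [sgnR, if_true, Bool.false_eq_true, if_false]
  ring

/-- Walsh coefficient of a set `Y` of unread entries: if `K` reads no entry of `Y`, then
`Σ_q w(q) χ_Y(q) K(q) = (∏_{f ∈ Y} (1 - 2 p_{f.1})) Σ_q w(q) K(q)`. -/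
theorem arrSum_chiY_mul :
    ∀ {m k : ℕ} (p : Fin m → ℝ) (Y : Finset (Fin m × Fin k)) (K : (Fin m × Fin k → Bool) → ℝ),
      (∀ f ∈ Y, ∀ (q : Fin m × Fin k → Bool) (b : Bool), K (Function.update q f b) = K q) →
      arrSum p (fun q => chiY Y q * K q) = (∏ f ∈ Y, (1 - 2 * p f.1)) * arrSum p K := by
  intro m k p Y K hK
  induction Y using Finset.induction_on generalizing K with
  | empty => simp [chiY, arrSum]
  | @insert f₀ Y hf₀ ih =>
    have hK0 : ∀ q b, K (Function.update q f₀ b) = K q := hK f₀ (mem_insert_self f₀ Y)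
    have hKY : ∀ f ∈ Y, ∀ q b, K (Function.update q f b) = K q := fun f hf => hK f (mem_insert_of_mem hf)
    -- `χ_{insert f₀ Y} K = sgn(q f₀) · (χ_Y K)` and `χ_Y K` does not read `f₀`
    have hsplit : (fun q => chiY (insert f₀ Y) q * K q) = fun q => sgnR (q f₀) * (chiY Y q * K q) := by
      funext q
      simp only [chiY, Finset.prod_insert hf₀, mul_assoc]
    have hinv : ∀ q b, chiY Y (Function.update q f₀ b) * K (Function.update q f₀ b) = chiY Y q * K q := by
      intro q b
      rw [hK0]
      congr 1
      exact Finset.prod_congr rfl fun f hf => by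
        rw [Function.update_of_ne (ne_of_mem_of_not_mem hf hf₀)]
    rw [hsplit, arrSum_sgnR_mul p f₀ _ hinv, ih _ hKY, Finset.prod_insert hf₀, mul_assoc]

/-- Bias bound: `|∏_{f ∈ Y} (1 - 2 p_{f.1})| ≤ θ ^ #Y ≤ θ ^ n` for `#Y ≥ n`, `0 ≤ θ ≤ 1`. -/
theorem abs_prod_bias_le (p : Fin m → ℝ) (θ : ℝ) (hθ0 : 0 ≤ θ) (hθ1 : θ ≤ 1)
    (hpθ : ∀ c, |1 - 2 * p c| ≤ θ) (Y : Finset (Fin m × Fin k)) (n : ℕ) (hn : n ≤ Y.card) :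
    |∏ f ∈ Y, (1 - 2 * p f.1)| ≤ θ ^ n := by
  rw [Finset.abs_prod]
  calc ∏ f ∈ Y, |1 - 2 * p f.1| ≤ ∏ _f ∈ Y, θ :=
        Finset.prod_le_prod (fun f _ => abs_nonneg _) fun f _ => hpθ f.1
    _ = θ ^ Y.card := Finset.prod_const θ
    _ ≤ θ ^ n := pow_le_pow_of_le_one hθ0 hθ1 hn

end Summit.CriticalPhenomena.CardyFormulaZ2.Theorems.IKLinearTransport.PinnedDiagramExchange.ScreeningArray
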